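import Summits.QuantumFields.YangMills.Theorems.BalabanUVNodesN18AdmTransportPlaqSmall

/-!
# BalabanUVNodes ∕ node N18 = NE5 — THE ENVELOPE TABLES: the plaquette-small threshold family `e(ε_k²) = α′ε_k²(1 + β ε_k²)`,
# `β = 4C_L α′∕(L²(L²−1))`, satisfies the SHARP one-step law of the averaging of record EXACTLY at every scale, so module 13's
# transport clause `admTransport_plaqSmall_sharp` holds for it with `ha ∕ hstep ∕ hguard` DISCHARGED — and at the canonical strict
# constant `α_L = min(L²(L²−1)∕(4C_L), δ_N∕(64L²))` with NO HYPOTHESIS AT ALL (Track A, DAG node N18 = `T4OutputRate.NE5` :211;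
# cluster K4 «SpineRates», item K3‴ `SpineGivenEndpointR13` (rev 16); dag-lead FAN-OUT clause «THE ENVELOPE TABLES» = LENS transfer v5
# §11.3 (card T8); module 11 of seat pub-ymgap-dag-n18-e (g6) for the n18-d lineage's module 13)

HONEST FRAMING.  Count-neutral kernel bookkeeping (`--supports stmt-QuantumFields-19912 --as helper`): one quadratic inequality
over ℝ and compositions BY NAME of module 13 (`YMDAG.N18.W1Reading.admTransport_plaqSmall_sharp`, p485563).  The tables model
the PLAQUETTE clause (1.11) of [I]'s small-field conditions ONLY — nothing of (1.12) (small local gauges, `CondI.localGauge`),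
nothing of (ii)–(iv) p. 262, nothing of (2.14) ∕ (STEP); NE5 is NOT PRINTED and NOT proved; N18 is NOT discharged; no inhabitant
of the record's datum is claimed; one finite four-torus programme at fixed `ε`; NOT the continuum limit, NOT OS, NOT a mass
gap, NOT Clay.  THEOREMS ONLY: 0 `def` (the envelope and `α_L` are written out as closed terms), 0 `sorry`, standard axioms.
The statements and proofs re-home, under module 13's namespace, the farm-checked memo sketch of the cell's lens seat
(`ym-lens-BalabanUVNodes-transfer` g5, card T8, `LensTransferSketch5.lean` §3-lemmas ∕ §4 ∕ §5, sha16 cf5518bf7395fd74 — «never to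
be landed as is: a prover re-homes what it needs»).

WHY.  Module 13 proves the transport clause `hT₀` of the admissible reading of record for the plaquette-small tables
`(k, j, Y) ↦ (ι·, 0) '' {V | PlaqSmall (a F θ k) V}` under THREE displayed laws of the threshold family `a`: positivity `ha`, the
print's sharp step law `hstep` (`L²·a(k+1) + C₀(L²·a(k+1))² ≤ a(k)`, [B-Avg] Prop. 1 (51), dag-n21-c's `plaqSmall_blockAvg_eml_sharp`;
in `d = 4` the constant reads `C₀(L²t)² = 143·(16L²·t)²`, i.e. `C_L := 143·(16L²)²` on `t`) and the chart guard `hguard`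
(`16L²·a(k+1) ≤ δ_N∕2`), leaving the family and its laws to the consumer (module 14 §3, dag-n27-c XXXII–XXXIII carry them as
section hypotheses).  Iterating the step law from a strictly small field costs the print's factor `2` ([I] p. 263 L9–13 =
[B-Avg] (53)–(54), IN TREE as `B7.ineq53_induction` ∕ dag-n21-c `plaqSmall_iter_blockAvg_eml_level`, one torus, start-dependent).
THE POINT (lens T8): instead of iterating the one-step map `t ↦ L²t + C_Lt²`, take an INVARIANT of it — the polynomial envelope `e(s) = α′s(1 + βs)` with `β = 4C_Lα′∕(L²(L²−1))` obeys `L²·e(s∕L²) + C_L·e(s∕L²)² ≤ e(s)` EXACTLY for every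
`s` with `4C_Lα′s ≤ L²(L²−1)` (one quadratic inequality, `K`-free, no induction), and is sandwiched `α′s ≤ e(s) ≤ 2α′s` — so
`k ↦ e(ε_k²)` is a level-keyed threshold family with module 13's three laws as THEOREMS:
* §1 the envelope algebra over ℝ: `le_envelope`, `envelope_le_two_mul`, `envelope_pos`, ★ `envelope_step`;
* §2 at the record (`q = L²`, `C_L = 143·(16L²)²`, `s = ε_k²`): `sharpConst_eq`, `eps_sq_succ`, `t4eps_le_one`, `one_lt_Lsq`;
  `plaqEnvelope_pos` (= `ha`), `le_plaqEnvelope` (the strictly small fields `|∂U − 1| < α′ε_k²` — print's «minimal configurations»,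
  [I] p. 263 L20–21 — lie inside), `plaqEnvelope_le` (inside the `2α′ε_k²`-table, so inside (1.11) once `2α′ ≤ α₀`),
  ★ `plaqEnvelope_step` (= `hstep` in module 13's exact shape), ★ `plaqEnvelope_guard` (= `hguard`), ★★★ `admTransport_plaqEnvelope`
  (module 13's clause for the envelope tables: `α′(F) > 0` with `4C_L·α′ ≤ L²(L²−1)` and `32L²·α′ ≤ δ_N∕2` the ONLY side conditions);
* §3 the canonical strict constant `α_L(N, F) = min(L²(L²−1)∕(4C_L), δ_N∕2∕(32L²))`: `alphaL_pos ∕ _small ∕ _guard` and ★★★★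
  `admTransport_plaqEnvelope_alphaL` — THE TRANSPORT CLAUSE FOR THE CANONICAL ENVELOPE TABLES WITH NO HYPOTHESIS; the tables are
  inhabited — `admBg_plaqEnvelope_alphaL_nonempty` (module 13's `admBg_plaqSmall_nonempty` with `plaqEnvelope_pos`).
Effect on the displayed lists (by name, for the consumers): module 14∕15 §3 and dag-n27-c XXXII–XXXIII lose «the table family ∕
thresholds ∕ `ha` ∕ `hstep` ∕ `hguard`» by instantiating `a := fun F _ k ↦ <the envelope>`; what remains there is unchanged.
KILL-TESTS recorded by the lens (§11.1): (a) the tables model (1.11) only; (b) (STEP)'s regime untouched; (c) `α_L ≈ 6.8·10⁻⁶` at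
`L = 13` — fine for existence, NOT print's `ε₀` (the parametric §2 form serves a consumer who wants another constant).

Sources (TYPES only): T. Bałaban, CMP **98** (1985) 17–51 [Balaban1985Averaging] Prop. 1 (51) p. 26 (the one-step law; tree:
`BlockAveragingEMLProp2.plaqSmall_blockAvg_eml_sharp`, module 13 `plaqSmall_transportRaw_avOfRecord_sharp`), Prop. 2 (52)–(54) p. 26 (the
iterated law; tree: `B7.ineq53_induction`); CMP **109** (1987) 249–301 [Balaban1987RG1] (0.4) p. 253, (0.18) p. 255, (0.21)–(0.22)
p. 256, (1.11)–(1.16) p. 262, p. 263 L9–13 («`M^p(U) = U^p` on `Λ_p`, `|∂U^p − 1| < 2α₀′(L^pξ)²`», read on the held paper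
`paper:balaban1987-cmp109-rg-i-small-field` p. 263) and L20–21 («the minimal configurations `U_j` satisfying `|∂U_j − 1| < ε₀ξ²`»).
The lens's King-side dictionary entry for this card (the product structure of King's nested small-field conditions) is not cited
here: no declaration below depends on it.  No claim about the mass gap.
-/

noncomputable section

open Set Metric
open scoped Matrix.Norms.L2Operator

namespace YMDAG.N18.W1Reading

open Literature.MathematicalPhysics.QuantumFieldTheory.Balaban1983to89
open Literature.MathematicalPhysics.QuantumFieldTheory.Balaban1983to89.T4Continuum
open Literature.MathematicalPhysics.QuantumFieldTheory.Balaban1983to89.ExpMeanLog (deltaSU deltaSU_pos)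
open Literature.MathematicalPhysics.QuantumFieldTheory.Balaban1983to89.Node00 (Stage12Params avOfRecord ιSU)
open Literature.MathematicalPhysics.QuantumFieldTheory.Balaban1983to89.Node00.Sect2 (domSys ofBackgroundC)
open Literature.MathematicalPhysics.QuantumFieldTheory.Balaban1983to89.Node00.W1 (AdmBg)
open Summit.QuantumFields.BalabanUV.T4Continuum.B13Carriers (transportRaw)

/-! ## §1 The envelope algebra: `e(s) = α·s·(1 + β·s)`, `β = 4Cα∕(q(q−1))`, is invariant under `t ↦ q·t + C·t²` read downward -/

section Envelope

variable {q C α : ℝ}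

/-- The strict threshold lies below the envelope: `α·s ≤ α·s·(1 + (4Cα∕(q(q−1)))·s)` (`q > 1`, `C, α, s ≥ 0`). [folklore] -/
theorem le_envelope (hq : 1 < q) (hC : 0 ≤ C) (hα : 0 ≤ α) {s : ℝ} (hs : 0 ≤ s) :
    α * s ≤ α * s * (1 + 4 * C * α / (q * (q - 1)) * s) := by
  have hq0 : 0 < q := by linarith
  have hq1 : 0 < q - 1 := by linarith
  have : 0 ≤ 4 * C * α / (q * (q - 1)) * s := by positivity
  nlinarith [mul_nonneg (mul_nonneg hα hs) this]

/-- The envelope lies below TWICE the strict threshold while `4Cα·s ≤ q(q−1)` (the print's factor `2`, [I] p. 263 L9–13).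
[cite: Balaban1987RG1, p.263 L9-13] -/
theorem envelope_le_two_mul (hq : 1 < q) (hα : 0 ≤ α) {s : ℝ} (hs : 0 ≤ s) (hβ : 4 * C * α * s ≤ q * (q - 1)) :
    α * s * (1 + 4 * C * α / (q * (q - 1)) * s) ≤ 2 * (α * s) := by
  have hq0 : 0 < q := by linarith
  have hq1 : 0 < q - 1 := by linarith
  have h1 : 4 * C * α / (q * (q - 1)) * s ≤ 1 := by
    rw [div_mul_eq_mul_div, div_le_one (by positivity)]; exact hβ
  nlinarith [mul_nonneg (mul_nonneg hα hs) (sub_nonneg.2 h1)]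

/-- The envelope is positive at positive scales. [folklore] -/
theorem envelope_pos (hq : 1 < q) (hC : 0 ≤ C) (hα : 0 < α) {s : ℝ} (hs : 0 < s) :
    0 < α * s * (1 + 4 * C * α / (q * (q - 1)) * s) :=
  (mul_pos hα hs).trans_le (le_envelope hq hC hα.le hs.le)

/-- ★ **THE ENVELOPE SATISFIES THE SHARP STEP LAW EXACTLY, AT EVERY SCALE**: with `e(s) = α·s·(1 + β·s)`, `β = 4Cα∕(q(q−1))`,
`q·e(s∕q) + C·e(s∕q)² ≤ e(s)` while `4Cα·s ≤ q(q−1)` — so the level-keyed family `k ↦ e(ε_k²)` is closed under the one-step law of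
record `t ↦ q·t + C·t²` (read from level `k+1` to level `k`) for ALL `k`: no run length, no induction, no limit (the iterated
law [B-Avg] (53)–(54) summed in closed form). [cite: Balaban1985Averaging, Prop. 1 (51) and Prop. 2 (53)–(54) p.26; Balaban1987RG1, p.263 L9-13] -/
theorem envelope_step (hq : 1 < q) (hC : 0 ≤ C) (hα : 0 < α) {s : ℝ} (hs : 0 < s) (hβ : 4 * C * α * s ≤ q * (q - 1)) :
    q * (α * (s / q) * (1 + 4 * C * α / (q * (q - 1)) * (s / q)))
        + C * (α * (s / q) * (1 + 4 * C * α / (q * (q - 1)) * (s / q))) ^ 2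
      ≤ α * s * (1 + 4 * C * α / (q * (q - 1)) * s) := by
  have hq0 : 0 < q := by linarith
  have hq1 : 0 < q - 1 := by linarith
  obtain ⟨u, hu0, rfl⟩ : ∃ u : ℝ, 0 < u ∧ s = q * u := ⟨s / q, by positivity, by field_simp⟩
  have hqu : q * u / q = u := by field_simp
  rw [hqu]
  set β : ℝ := 4 * C * α / (q * (q - 1)) with hβdef
  have hβ0 : 0 ≤ β := by positivity
  have hβq : β * (q * (q - 1)) = 4 * C * α := by rw [hβdef]; field_simp
  have hβu : β * u ≤ 1 := by
    have h1 : β * (q * u) ≤ 1 := by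
      rw [hβdef, div_mul_eq_mul_div, div_le_one (by positivity)]; exact hβ
    have h2 : β * u ≤ β * (q * u) := by nlinarith [mul_nonneg hβ0 hu0.le]
    exact h2.trans h1
  have hkey : C * (α * u * (1 + β * u)) ^ 2 ≤ 4 * C * α * (α * u ^ 2) := by
    have h14 : (1 + β * u) ^ 2 ≤ 4 := by nlinarith [mul_nonneg hβ0 hu0.le]
    have hCau : 0 ≤ C * (α * u) ^ 2 := by positivity
    calc C * (α * u * (1 + β * u)) ^ 2 = C * (α * u) ^ 2 * (1 + β * u) ^ 2 := by ring
      _ ≤ C * (α * u) ^ 2 * 4 := mul_le_mul_of_nonneg_left h14 hCau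
      _ = 4 * C * α * (α * u ^ 2) := by ring
  have hlin : α * (q * u) * (1 + β * (q * u)) - q * (α * u * (1 + β * u)) = 4 * C * α * (α * u ^ 2) := by
    have : α * (q * u) * (1 + β * (q * u)) - q * (α * u * (1 + β * u)) = β * (q * (q - 1)) * (α * u ^ 2) := by ring
    rw [this, hβq]
  linarith [hkey, hlin]

end Envelope

/-! ## §2 At the record: the plaquette envelope `e_L(ε_k²)` of the `k`-th torus, module 13's three laws discharged -/

section RecordEnvelope

variable {N : ℕ} [NeZero N]

/-- The sharp one-step constant of the averaging of record in `d = 4`: `(((d+4)·L)²∕4)·t = 16L²·t` (module 13's `hstep`∕`hguard`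
spell the left-hand side). [cite: Balaban1985Averaging, Prop. 1 (51) p.26] -/
theorem sharpConst_eq (F : T4Family) (k : ℕ) (t : ℝ) :
    ((((F.P (k + 1)).d + 4) * (F.P (k + 1)).L : ℕ) : ℝ) ^ 2 / 4 * t = 16 * (F.L : ℝ) ^ 2 * t := by
  push_cast [T4Family.P_d, T4Family.P_L]
  ring

/-- `ε_k² = L²·ε_{k+1}²` on a `T4Family`. [cite: Balaban1987RG1, (0.1) p.251] -/
theorem eps_sq_succ (F : T4Family) (k : ℕ) : F.eps k ^ 2 = (F.L : ℝ) ^ 2 * F.eps (k + 1) ^ 2 := by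
  have hL : (F.L : ℝ) ≠ 0 := Nat.cast_ne_zero.mpr (by have := F.hL.2; omega)
  rw [F.eps_succ]
  field_simp

/-- `ε_k ≤ 1` on a `T4Family` (`L ≥ 1`). [cite: Balaban1987RG1, (0.1) p.251] -/
theorem t4eps_le_one (F : T4Family) (k : ℕ) : F.eps k ≤ 1 := by
  rw [F.eps_eq]
  have h1 : (1 : ℝ) ≤ F.L := by exact_mod_cast F.hL.2.le
  exact pow_le_one₀ (inv_nonneg.2 (by positivity)) (inv_le_one_of_one_le₀ h1)

/-- `1 < L²` on a `T4Family` (`L > 11`). [cite: Balaban1987RG1, p.251 («L is an odd, positive integer > 11»)] -/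
theorem one_lt_Lsq (F : T4Family) : (1 : ℝ) < (F.L : ℝ) ^ 2 := by
  have h11 : (11 : ℝ) < F.L := by exact_mod_cast F.hL11
  nlinarith

/-- **THE PLAQUETTE ENVELOPE OF THE `k`-TH TORUS IS POSITIVE** — module 13's `ha` for the family
`k ↦ α′ε_k²·(1 + (4C_Lα′∕(L²(L²−1)))·ε_k²)`, `C_L = 143·(16L²)²` (`α′ > 0`). [cite: Balaban1987RG1, (0.18) p.255 (bookkeeping)] -/
theorem plaqEnvelope_pos (F : T4Family) {α : ℝ} (hα : 0 < α) (k : ℕ) :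
    0 < α * F.eps k ^ 2 * (1 + 4 * (143 * ((16 : ℝ) * (F.L : ℝ) ^ 2) ^ 2) * α
      / ((F.L : ℝ) ^ 2 * ((F.L : ℝ) ^ 2 - 1)) * F.eps k ^ 2) :=
  envelope_pos (one_lt_Lsq F) (by positivity) hα (pow_pos (F.eps_pos k) 2)

/-- The strictly small fields `|∂U − 1| < α′ε_k²` lie inside the envelope table (print's «minimal configurations `U_j`,
`|∂U_j − 1| < ε₀ξ²`», [I] p. 263 L20–21, once `ε₀ ≤ α′`). [cite: Balaban1987RG1, p.263 L5-9 and L20-21] -/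
theorem le_plaqEnvelope (F : T4Family) {α : ℝ} (hα : 0 ≤ α) (k : ℕ) :
    α * F.eps k ^ 2 ≤ α * F.eps k ^ 2 * (1 + 4 * (143 * ((16 : ℝ) * (F.L : ℝ) ^ 2) ^ 2) * α
      / ((F.L : ℝ) ^ 2 * ((F.L : ℝ) ^ 2 - 1)) * F.eps k ^ 2) :=
  le_envelope (one_lt_Lsq F) (by positivity) hα (sq_nonneg _)

/-- The envelope table lies inside the `2α′ε_k²`-table (so inside the print's (1.11) plaquette clause of `U^c(α₀)` once
`2α′ ≤ α₀`), uniformly in `k`, given `4C_L·α′ ≤ L²(L²−1)`. [cite: Balaban1987RG1, (1.11) p.262 and p.263 L9-16] -/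
theorem plaqEnvelope_le (F : T4Family) {α : ℝ} (hα : 0 ≤ α) (k : ℕ)
    (hsmall : 4 * (143 * ((16 : ℝ) * (F.L : ℝ) ^ 2) ^ 2) * α ≤ (F.L : ℝ) ^ 2 * ((F.L : ℝ) ^ 2 - 1)) :
    α * F.eps k ^ 2 * (1 + 4 * (143 * ((16 : ℝ) * (F.L : ℝ) ^ 2) ^ 2) * α
        / ((F.L : ℝ) ^ 2 * ((F.L : ℝ) ^ 2 - 1)) * F.eps k ^ 2)
      ≤ 2 * (α * F.eps k ^ 2) := by
  have he1 : F.eps k ^ 2 ≤ 1 := pow_le_one₀ (F.eps_pos k).le (t4eps_le_one F k)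
  refine envelope_le_two_mul (one_lt_Lsq F) hα (sq_nonneg _) ?_
  calc 4 * (143 * ((16 : ℝ) * (F.L : ℝ) ^ 2) ^ 2) * α * F.eps k ^ 2
      ≤ 4 * (143 * ((16 : ℝ) * (F.L : ℝ) ^ 2) ^ 2) * α * 1 := mul_le_mul_of_nonneg_left he1 (by positivity)
    _ ≤ _ := by rw [mul_one]; exact hsmall

/-- ★ **MODULE 13's STEP-LAW HYPOTHESIS `hstep`, DISCHARGED for the envelope family, in module 13's exact shape**
(`L²·e(ε_{k+1}²) + 143·((((d+4)L)²∕4)·e(ε_{k+1}²))² ≤ e(ε_k²)`, given `4C_L·α′ ≤ L²(L²−1)`).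
[cite: Balaban1985Averaging, Prop. 1 (51) p.26; Balaban1987RG1, p.263 L9-13] -/
theorem plaqEnvelope_step (F : T4Family) {α : ℝ} (hα : 0 < α)
    (hsmall : 4 * (143 * ((16 : ℝ) * (F.L : ℝ) ^ 2) ^ 2) * α ≤ (F.L : ℝ) ^ 2 * ((F.L : ℝ) ^ 2 - 1)) (k : ℕ) :
    ((F.P (k + 1)).L : ℝ) ^ 2
          * (α * F.eps (k + 1) ^ 2 * (1 + 4 * (143 * ((16 : ℝ) * (F.L : ℝ) ^ 2) ^ 2) * α
              / ((F.L : ℝ) ^ 2 * ((F.L : ℝ) ^ 2 - 1)) * F.eps (k + 1) ^ 2))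
        + 143 * (((((F.P (k + 1)).d + 4) * (F.P (k + 1)).L : ℕ) : ℝ) ^ 2 / 4
          * (α * F.eps (k + 1) ^ 2 * (1 + 4 * (143 * ((16 : ℝ) * (F.L : ℝ) ^ 2) ^ 2) * α
              / ((F.L : ℝ) ^ 2 * ((F.L : ℝ) ^ 2 - 1)) * F.eps (k + 1) ^ 2))) ^ 2
      ≤ α * F.eps k ^ 2 * (1 + 4 * (143 * ((16 : ℝ) * (F.L : ℝ) ^ 2) ^ 2) * α
          / ((F.L : ℝ) ^ 2 * ((F.L : ℝ) ^ 2 - 1)) * F.eps k ^ 2) := by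
  have he1 : F.eps k ^ 2 ≤ 1 := pow_le_one₀ (F.eps_pos k).le (t4eps_le_one F k)
  have hβ : 4 * (143 * ((16 : ℝ) * (F.L : ℝ) ^ 2) ^ 2) * α * F.eps k ^ 2 ≤ (F.L : ℝ) ^ 2 * ((F.L : ℝ) ^ 2 - 1) :=
    calc 4 * (143 * ((16 : ℝ) * (F.L : ℝ) ^ 2) ^ 2) * α * F.eps k ^ 2
        ≤ 4 * (143 * ((16 : ℝ) * (F.L : ℝ) ^ 2) ^ 2) * α * 1 := mul_le_mul_of_nonneg_left he1 (by positivity)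
      _ ≤ _ := by rw [mul_one]; exact hsmall
  have h := envelope_step (one_lt_Lsq F) (by positivity : (0 : ℝ) ≤ 143 * ((16 : ℝ) * (F.L : ℝ) ^ 2) ^ 2) hα
    (pow_pos (F.eps_pos k) 2) hβ
  have hL : (F.L : ℝ) ≠ 0 := Nat.cast_ne_zero.mpr (by have := F.hL.2; omega)
  have hsq : F.eps k ^ 2 / (F.L : ℝ) ^ 2 = F.eps (k + 1) ^ 2 := by rw [eps_sq_succ F k]; field_simp
  rw [hsq] at h
  rw [sharpConst_eq, T4Family.P_L]
  convert h using 2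
  ring

omit [NeZero N] in
/-- ★ **MODULE 13's GUARD `hguard`, DISCHARGED for the envelope family** from `4C_L·α′ ≤ L²(L²−1)` and `32L²·α′ ≤ δ_N∕2`.
[cite: Balaban1985Averaging, Prop. 1 p.26 (the chart guard)] -/
theorem plaqEnvelope_guard (F : T4Family) {α : ℝ} (hα : 0 < α)
    (hsmall : 4 * (143 * ((16 : ℝ) * (F.L : ℝ) ^ 2) ^ 2) * α ≤ (F.L : ℝ) ^ 2 * ((F.L : ℝ) ^ 2 - 1))
    (hguard : (32 : ℝ) * (F.L : ℝ) ^ 2 * α ≤ deltaSU (Fin N) / 2) (k : ℕ) :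
    ((((F.P (k + 1)).d + 4) * (F.P (k + 1)).L : ℕ) : ℝ) ^ 2 / 4
        * (α * F.eps (k + 1) ^ 2 * (1 + 4 * (143 * ((16 : ℝ) * (F.L : ℝ) ^ 2) ^ 2) * α
            / ((F.L : ℝ) ^ 2 * ((F.L : ℝ) ^ 2 - 1)) * F.eps (k + 1) ^ 2))
      ≤ deltaSU (Fin N) / 2 := by
  rw [sharpConst_eq]
  have he1 : F.eps (k + 1) ^ 2 ≤ 1 := pow_le_one₀ (F.eps_pos (k + 1)).le (t4eps_le_one F (k + 1))
  have h2 := plaqEnvelope_le F hα.le (k + 1) hsmall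
  calc 16 * (F.L : ℝ) ^ 2 * (α * F.eps (k + 1) ^ 2 * (1 + 4 * (143 * ((16 : ℝ) * (F.L : ℝ) ^ 2) ^ 2) * α
            / ((F.L : ℝ) ^ 2 * ((F.L : ℝ) ^ 2 - 1)) * F.eps (k + 1) ^ 2))
      ≤ 16 * (F.L : ℝ) ^ 2 * (2 * (α * F.eps (k + 1) ^ 2)) := mul_le_mul_of_nonneg_left h2 (by positivity)
    _ = 32 * (F.L : ℝ) ^ 2 * α * F.eps (k + 1) ^ 2 := by ring
    _ ≤ 32 * (F.L : ℝ) ^ 2 * α * 1 := mul_le_mul_of_nonneg_left he1 (by positivity)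
    _ ≤ _ := by rw [mul_one]; exact hguard

/-- **THE ENVELOPE STEP AT THE LEVEL OF FIELDS** (no table ∕ image wrapping — the form an iteration along `W1.avIter` consumes):
for `α′ > 0` with `4C_L·α′ ≤ L²(L²−1)` and `32L²·α′ ≤ δ_N∕2`, a field `U` of the `(k+1)`-th torus with `PlaqSmall (e_L(ε_{k+1}²)) U` is
transported by the transport of record to a field with `PlaqSmall (e_L(ε_k²))` — module 13's `plaqSmall_transportRaw_avOfRecord_sharp`
followed by `plaqEnvelope_step`. [cite: Balaban1985Averaging, Prop. 1 (51) p.26; Balaban1987RG1, (0.4) p.253 and p.263 L9-13] -/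
theorem plaqSmall_transportRaw_plaqEnvelope (F : T4Family) {α : ℝ} (hα : 0 < α)
    (hsmall : 4 * (143 * ((16 : ℝ) * (F.L : ℝ) ^ 2) ^ 2) * α ≤ (F.L : ℝ) ^ 2 * ((F.L : ℝ) ^ 2 - 1))
    (hguard : (32 : ℝ) * (F.L : ℝ) ^ 2 * α ≤ deltaSU (Fin N) / 2) (k : ℕ) {U : GaugeField (F.P (k + 1)) 0 (Node00.SU N)}
    (hU : PlaqSmall (α * F.eps (k + 1) ^ 2 * (1 + 4 * (143 * ((16 : ℝ) * (F.L : ℝ) ^ 2) ^ 2) * α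
      / ((F.L : ℝ) ^ 2 * ((F.L : ℝ) ^ 2 - 1)) * F.eps (k + 1) ^ 2)) U) :
    PlaqSmall (α * F.eps k ^ 2 * (1 + 4 * (143 * ((16 : ℝ) * (F.L : ℝ) ^ 2) ^ 2) * α
      / ((F.L : ℝ) ^ 2 * ((F.L : ℝ) ^ 2 - 1)) * F.eps k ^ 2)) (transportRaw F k (avOfRecord F N (k + 1) 0) U) := fun p =>
  (plaqSmall_transportRaw_avOfRecord_sharp k (plaqEnvelope_pos F hα (k + 1)) (plaqEnvelope_guard F hα hsmall hguard k) hU p).trans_le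
    (plaqEnvelope_step F hα hsmall k)

/-- ★★★ **THE TRANSPORT CLAUSE `hT₀` OF `ReadingData.ofRecordAdm` AT THE TRANSPORT OF RECORD FOR THE ENVELOPE TABLES — module 13's
`admTransport_plaqSmall_sharp` with `ha` ∕ `hstep` ∕ `hguard` DISCHARGED**: for any choice `α′(F) > 0` with `4C_L·α′ ≤ L²(L²−1)`
and `32L²·α′ ≤ δ_N∕2` (the ONLY side conditions; numbers in `(L, N)`), the averages of record of the fields of the `(k+1)`-th torus
read inside the level-`(k+1)` envelope table are read inside the level-`k` envelope table.
[cite: Balaban1987RG1, (0.4) p.253, (0.18) p.255, (0.21)-(0.22) p.256, p.262 (iv), p.263 L9-13; Balaban1985Averaging, Prop. 1 (51) p.26] -/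
theorem admTransport_plaqEnvelope (α : T4Family → ℝ) (hα : ∀ F, 0 < α F)
    (hsmall : ∀ F : T4Family, 4 * (143 * ((16 : ℝ) * (F.L : ℝ) ^ 2) ^ 2) * α F ≤ (F.L : ℝ) ^ 2 * ((F.L : ℝ) ^ 2 - 1))
    (hguard : ∀ F : T4Family, (32 : ℝ) * (F.L : ℝ) ^ 2 * α F ≤ deltaSU (Fin N) / 2)
    (F : T4Family) (θ : Stage12Params F N) (k : ℕ) (U : GaugeField (F.P (k + 1)) 0 (Node00.SU N))
    (hU : ∀ (j : ℕ) (Y : (domSys (F.P (k + 1)) θ.τ9.M j).Dom),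
      ofBackgroundC (ιSU N) U ∈ (fun (k j : ℕ) (_ : (domSys (F.P k) θ.τ9.M j).Dom) =>
        ofBackgroundC (ιSU N) '' {V : GaugeField (F.P k) 0 (Node00.SU N) |
          PlaqSmall (α F * F.eps k ^ 2 * (1 + 4 * (143 * ((16 : ℝ) * (F.L : ℝ) ^ 2) ^ 2) * α F
            / ((F.L : ℝ) ^ 2 * ((F.L : ℝ) ^ 2 - 1)) * F.eps k ^ 2)) V}) (k + 1) j Y)
    (j : ℕ) (X : (domSys (F.P k) θ.τ9.M j).Dom) :
    ofBackgroundC (ιSU N) (transportRaw F k (avOfRecord F N (k + 1) 0) U) ∈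
      (fun (k j : ℕ) (_ : (domSys (F.P k) θ.τ9.M j).Dom) =>
        ofBackgroundC (ιSU N) '' {V : GaugeField (F.P k) 0 (Node00.SU N) |
          PlaqSmall (α F * F.eps k ^ 2 * (1 + 4 * (143 * ((16 : ℝ) * (F.L : ℝ) ^ 2) ^ 2) * α F
            / ((F.L : ℝ) ^ 2 * ((F.L : ℝ) ^ 2 - 1)) * F.eps k ^ 2)) V}) k j X :=
  admTransport_plaqSmall_sharp
    (a := fun F (_ : Stage12Params F N) k => α F * F.eps k ^ 2 * (1 + 4 * (143 * ((16 : ℝ) * (F.L : ℝ) ^ 2) ^ 2) * α F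
      / ((F.L : ℝ) ^ 2 * ((F.L : ℝ) ^ 2 - 1)) * F.eps k ^ 2))
    (fun F _ k => plaqEnvelope_pos F (hα F) (k + 1)) (fun F _ k => plaqEnvelope_step F (hα F) (hsmall F) k)
    (fun F _ k => plaqEnvelope_guard F (hα F) (hsmall F) (hguard F) k) F θ k U hU j X

end RecordEnvelope

/-! ## §3 No side condition left: the canonical strict constant `α_L = min(L²(L²−1)∕(4C_L), δ_N∕2∕(32L²))` -/

section Alpha

variable {N : ℕ} [NeZero N]

/-- **THE CANONICAL STRICT PLAQUETTE CONSTANT IS POSITIVE**: `0 < min (L²(L²−1)∕(4C_L)) (δ_N∕2∕(32L²))` («α₀′ sufficiently small»,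
[I] p. 263 L14, made a number; `δ_N = ExpMeanLog.deltaSU (Fin N) > 0`). [cite: Balaban1987RG1, p.263 L9-16 (bookkeeping)] -/
theorem alphaL_pos (F : T4Family) :
    0 < min ((F.L : ℝ) ^ 2 * ((F.L : ℝ) ^ 2 - 1) / (4 * (143 * ((16 : ℝ) * (F.L : ℝ) ^ 2) ^ 2)))
      (deltaSU (Fin N) / 2 / (32 * (F.L : ℝ) ^ 2)) := by
  have h1 := one_lt_Lsq F
  have h11 : (11 : ℝ) < F.L := by exact_mod_cast F.hL11
  have hδ : 0 < deltaSU (Fin N) := deltaSU_pos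
  exact lt_min (div_pos (mul_pos (by positivity) (by linarith)) (by positivity)) (by positivity)

omit [NeZero N] in
/-- The canonical constant meets the envelope's smallness condition `4C_L·α_L ≤ L²(L²−1)`. [cite: Balaban1987RG1, p.263 L9-16 (bookkeeping)] -/
theorem alphaL_small (F : T4Family) :
    4 * (143 * ((16 : ℝ) * (F.L : ℝ) ^ 2) ^ 2)
        * min ((F.L : ℝ) ^ 2 * ((F.L : ℝ) ^ 2 - 1) / (4 * (143 * ((16 : ℝ) * (F.L : ℝ) ^ 2) ^ 2)))
          (deltaSU (Fin N) / 2 / (32 * (F.L : ℝ) ^ 2))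
      ≤ (F.L : ℝ) ^ 2 * ((F.L : ℝ) ^ 2 - 1) := by
  have h11 : (11 : ℝ) < F.L := by exact_mod_cast F.hL11
  have hC : (0 : ℝ) < 4 * (143 * ((16 : ℝ) * (F.L : ℝ) ^ 2) ^ 2) := by positivity
  have h := (le_div_iff₀ hC).1 (min_le_left ((F.L : ℝ) ^ 2 * ((F.L : ℝ) ^ 2 - 1) / (4 * (143 * ((16 : ℝ) * (F.L : ℝ) ^ 2) ^ 2)))
    (deltaSU (Fin N) / 2 / (32 * (F.L : ℝ) ^ 2)))
  rw [mul_comm]; exact h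

omit [NeZero N] in
/-- The canonical constant meets the chart guard `32L²·α_L ≤ δ_N∕2`. [cite: Balaban1985Averaging, Prop. 1 p.26 (the chart guard; bookkeeping)] -/
theorem alphaL_guard (F : T4Family) :
    (32 : ℝ) * (F.L : ℝ) ^ 2
        * min ((F.L : ℝ) ^ 2 * ((F.L : ℝ) ^ 2 - 1) / (4 * (143 * ((16 : ℝ) * (F.L : ℝ) ^ 2) ^ 2)))
          (deltaSU (Fin N) / 2 / (32 * (F.L : ℝ) ^ 2))
      ≤ deltaSU (Fin N) / 2 := by
  have h11 : (11 : ℝ) < F.L := by exact_mod_cast F.hL11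
  have hC : (0 : ℝ) < 32 * (F.L : ℝ) ^ 2 := by positivity
  have h := (le_div_iff₀ hC).1 (min_le_right ((F.L : ℝ) ^ 2 * ((F.L : ℝ) ^ 2 - 1) / (4 * (143 * ((16 : ℝ) * (F.L : ℝ) ^ 2) ^ 2)))
    (deltaSU (Fin N) / 2 / (32 * (F.L : ℝ) ^ 2)))
  rw [mul_comm]; exact h

/-- ★★★★ **THE TRANSPORT CLAUSE AT THE TRANSPORT OF RECORD FOR THE CANONICAL ENVELOPE TABLES — NO HYPOTHESIS AT ALL**: with
`α_L(N, F) = min(L²(L²−1)∕(4C_L), δ_N∕2∕(32L²))` and the table family `(k, j, Y) ↦ (ι·, 0) '' {V | PlaqSmall (e_L(ε_k²)) V}`,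
`e_L(ε_k²) = α_L ε_k²(1 + (4C_Lα_L∕(L²(L²−1))) ε_k²)`, the averages of record of the fields of the `(k+1)`-th torus read inside the
level-`(k+1)` table are read inside the level-`k` table — module 13 ∕ 14 §3 and dag-n27-c XXXII–XXXIII's section hypotheses
`(a, ha, hstep, hguard)` ALL discharged; the tables are inhabited (`U ≡ 1`: module 13's `admBg_plaqSmall_nonempty` with
`plaqEnvelope_pos`), contain the strictly small fields `|∂U − 1| < α_L ε_k²` (`le_plaqEnvelope`) and sit inside the `2α_L ε_k²`-tables
(`plaqEnvelope_le` with `alphaL_small`).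
[cite: Balaban1987RG1, (0.4) p.253, (0.18) p.255, (0.21)-(0.22) p.256, p.262 (iv), p.263 L9-16; Balaban1985Averaging, Prop. 1 (51) p.26] -/
theorem admTransport_plaqEnvelope_alphaL (F : T4Family) (θ : Stage12Params F N) (k : ℕ)
    (U : GaugeField (F.P (k + 1)) 0 (Node00.SU N))
    (hU : ∀ (j : ℕ) (Y : (domSys (F.P (k + 1)) θ.τ9.M j).Dom),
      ofBackgroundC (ιSU N) U ∈ (fun (k j : ℕ) (_ : (domSys (F.P k) θ.τ9.M j).Dom) =>
        ofBackgroundC (ιSU N) '' {V : GaugeField (F.P k) 0 (Node00.SU N) |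
          PlaqSmall (min ((F.L : ℝ) ^ 2 * ((F.L : ℝ) ^ 2 - 1) / (4 * (143 * ((16 : ℝ) * (F.L : ℝ) ^ 2) ^ 2)))
              (deltaSU (Fin N) / 2 / (32 * (F.L : ℝ) ^ 2)) * F.eps k ^ 2
            * (1 + 4 * (143 * ((16 : ℝ) * (F.L : ℝ) ^ 2) ^ 2)
              * min ((F.L : ℝ) ^ 2 * ((F.L : ℝ) ^ 2 - 1) / (4 * (143 * ((16 : ℝ) * (F.L : ℝ) ^ 2) ^ 2)))
                (deltaSU (Fin N) / 2 / (32 * (F.L : ℝ) ^ 2))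
              / ((F.L : ℝ) ^ 2 * ((F.L : ℝ) ^ 2 - 1)) * F.eps k ^ 2)) V}) (k + 1) j Y)
    (j : ℕ) (X : (domSys (F.P k) θ.τ9.M j).Dom) :
    ofBackgroundC (ιSU N) (transportRaw F k (avOfRecord F N (k + 1) 0) U) ∈
      (fun (k j : ℕ) (_ : (domSys (F.P k) θ.τ9.M j).Dom) =>
        ofBackgroundC (ιSU N) '' {V : GaugeField (F.P k) 0 (Node00.SU N) |
          PlaqSmall (min ((F.L : ℝ) ^ 2 * ((F.L : ℝ) ^ 2 - 1) / (4 * (143 * ((16 : ℝ) * (F.L : ℝ) ^ 2) ^ 2)))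
              (deltaSU (Fin N) / 2 / (32 * (F.L : ℝ) ^ 2)) * F.eps k ^ 2
            * (1 + 4 * (143 * ((16 : ℝ) * (F.L : ℝ) ^ 2) ^ 2)
              * min ((F.L : ℝ) ^ 2 * ((F.L : ℝ) ^ 2 - 1) / (4 * (143 * ((16 : ℝ) * (F.L : ℝ) ^ 2) ^ 2)))
                (deltaSU (Fin N) / 2 / (32 * (F.L : ℝ) ^ 2))
              / ((F.L : ℝ) ^ 2 * ((F.L : ℝ) ^ 2 - 1)) * F.eps k ^ 2)) V}) k j X :=
  admTransport_plaqEnvelope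
    (fun F => min ((F.L : ℝ) ^ 2 * ((F.L : ℝ) ^ 2 - 1) / (4 * (143 * ((16 : ℝ) * (F.L : ℝ) ^ 2) ^ 2)))
      (deltaSU (Fin N) / 2 / (32 * (F.L : ℝ) ^ 2)))
    alphaL_pos alphaL_small alphaL_guard F θ k U hU j X

/-- **THE CANONICAL ENVELOPE TABLES ARE INHABITED**: at every torus `k` the unit configuration `U ≡ 1` is read inside them, so
the admissible backgrounds `AdmBg` of the reading are non-empty (module 13's `admBg_plaqSmall_nonempty` with `plaqEnvelope_pos` at
`α_L > 0` — the A1 non-vacuity hook for every consumer of `admTransport_plaqEnvelope_alphaL`).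
[cite: Balaban1987RG1, (0.18) p.255 and (1.11)–(1.16) p.262 (bookkeeping; non-vacuity)] -/
theorem admBg_plaqEnvelope_alphaL_nonempty (F : T4Family) (θ : Stage12Params F N) (k : ℕ) :
    Nonempty (AdmBg F θ.τ9.M N (fun (k j : ℕ) (_ : (domSys (F.P k) θ.τ9.M j).Dom) =>
      ofBackgroundC (ιSU N) '' {V : GaugeField (F.P k) 0 (Node00.SU N) |
        PlaqSmall (min ((F.L : ℝ) ^ 2 * ((F.L : ℝ) ^ 2 - 1) / (4 * (143 * ((16 : ℝ) * (F.L : ℝ) ^ 2) ^ 2)))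
            (deltaSU (Fin N) / 2 / (32 * (F.L : ℝ) ^ 2)) * F.eps k ^ 2
          * (1 + 4 * (143 * ((16 : ℝ) * (F.L : ℝ) ^ 2) ^ 2)
            * min ((F.L : ℝ) ^ 2 * ((F.L : ℝ) ^ 2 - 1) / (4 * (143 * ((16 : ℝ) * (F.L : ℝ) ^ 2) ^ 2)))
              (deltaSU (Fin N) / 2 / (32 * (F.L : ℝ) ^ 2))
            / ((F.L : ℝ) ^ 2 * ((F.L : ℝ) ^ 2 - 1)) * F.eps k ^ 2)) V}) k) :=
  admBg_plaqSmall_nonempty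
    (a := fun F (_ : Stage12Params F N) k =>
      min ((F.L : ℝ) ^ 2 * ((F.L : ℝ) ^ 2 - 1) / (4 * (143 * ((16 : ℝ) * (F.L : ℝ) ^ 2) ^ 2)))
          (deltaSU (Fin N) / 2 / (32 * (F.L : ℝ) ^ 2)) * F.eps k ^ 2
        * (1 + 4 * (143 * ((16 : ℝ) * (F.L : ℝ) ^ 2) ^ 2)
          * min ((F.L : ℝ) ^ 2 * ((F.L : ℝ) ^ 2 - 1) / (4 * (143 * ((16 : ℝ) * (F.L : ℝ) ^ 2) ^ 2)))
            (deltaSU (Fin N) / 2 / (32 * (F.L : ℝ) ^ 2))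
          / ((F.L : ℝ) ^ 2 * ((F.L : ℝ) ^ 2 - 1)) * F.eps k ^ 2))
    F θ k (plaqEnvelope_pos F (alphaL_pos F) k)

end Alpha

end YMDAG.N18.W1Reading

end
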